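import Summits.Ventures.FusionMHD.Bench.SolovevPCFIterMercierMidThreshold
import Summits.Ventures.FusionMHD.Bench.SolovevPCFIterMercierQ1Threshold
import Summits.Ventures.FusionMHD.Bench.SolovevPCFIterMercierQ3Threshold
import HarnessLib

/-!
# F1 / MERCIER — the CERTIFIED THRESHOLD PROFILE of the ITER-like PCF Solov'ev equilibrium: axis, ρ/ρ_e = 1/4, 1/2, 3/4, edge
(venture LADDER-GRIDFUSION, rung F1.MERCIER-profile; cell `gridfusion`, seat `gridfusion-sos-6` (g3), 2026-08-27.)

One citable statement collecting the five two-sided kernel certificates of the flux-coordinate Mercier criterion (Jardin 2010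
(8.134), `Mercier.FluxForm.SurfaceData.MercierCriterion`, on model-5's records `lcGGJData` of the tree's own functionals of the
typed `Ψ` on the printed loops; near the axis Bateman (7.3.2), `Mercier.NearAxis.MercierCriterion`):

| surface | record | threshold bracket (certified, two-sided) | file |
|---|---|---|---|
| magnetic axis (limit) | `MercierCriterion (q0 F) elong 0 0` | `F_M ∈ [0.61902799408906489484, …485]` | `…MercierAxis` (p472219) |
| `ρ/ρ_e = 1/4` | `lcQ1Data F` | `[0.601603121, 0.601603122]` | `…MercierQ1Threshold` |
| `ρ/ρ_e = 1/2` | `lcMidData F` | `[0.550794833, 0.550794834]` | `…MercierMidThreshold` (p497831) |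
| `ρ/ρ_e = 3/4` | `lcQ3Data F` | `[0.470664736, 0.470664737]` | `…MercierQ3Threshold` |
| edge `Ψ = 0` | `lcEdgeData F` | `[0.36703156245, 0.36703156248]` | `…MercierEdgeThreshold` (p492537) |

THIS FILE proves: `thresholds_monotone` — the five brackets are STRICTLY ORDERED, increasing toward the axis;
`mercier_profile_of_ge` — for every `F ≥ F_M⁺(axis)` the criterion holds on all five surfaces; `not_mercier_profile_of_le` — for
every `0 < F ≤ g_M⁻(edge)` it fails on all five; `mercier_profile_window` — for `F` between the 1/2- and 1/4-brackets it holds at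
the edge, 3/4 and 1/2 but FAILS at 1/4 and on the axis (the Mercier-unstable region is an inner core that shrinks as `F` grows:
the VALIDATED picture «the axis binds», now certified at five surfaces). Interior surfaces other than these five are NOT certified
here (the exact quadratic structure `SolovevFluxSurfaceGGJQuadratic` makes each further surface a 7-integral job for the generators in
HOME/cert/sos-6/ggjbridge/).
HONEST FRAMING: CERTIFIED statements about the MODEL (ideal MHD, analytic fixed-boundary PCF Solov'ev equilibrium
[cite: PatakiCerfonFreidberg2013, §6.1], `F = RB_φ` a free parameter); Mercier is a NECESSARY local-interchange criterion; nothing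
here says a plasma or device is stable. No `decide` in this file.
-/

noncomputable section

open Real
open Literature.MathematicalPhysics.MHD

namespace Summit.Ventures.FusionMHD.Bench.SolovevPCFIter.MercierProfile

open Summit.Ventures.FusionMHD.Bench.SolovevPCFIter

/-- **The five certified threshold brackets are strictly ordered, increasing toward the axis:**
`g_M⁺(edge) < g_M⁻(3/4) ≤ g_M⁺(3/4) < g_M⁻(1/2) ≤ g_M⁺(1/2) < g_M⁻(1/4) ≤ g_M⁺(1/4) < F_M⁻(axis)`. [folklore] -/
theorem thresholds_monotone :
    MercierEdge.gMercEdgeHi < MercierQ3.gMercQ3Lo ∧ MercierQ3.gMercQ3Hi < MercierMid.gMercMidLo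
    ∧ MercierMid.gMercMidHi < MercierQ1.gMercQ1Lo ∧ MercierQ1.gMercQ1Hi < MercierAxis.FmercLo := by
  unfold MercierEdge.gMercEdgeHi MercierQ3.gMercQ3Lo MercierQ3.gMercQ3Hi MercierMid.gMercMidLo MercierMid.gMercMidHi
    MercierQ1.gMercQ1Lo MercierQ1.gMercQ1Hi MercierAxis.FmercLo
  refine ⟨by norm_num, by norm_num, by norm_num, by norm_num⟩

/-- **For every `F ≥ F_M⁺(axis) = 0.61902799408906489485` the Mercier criterion holds on the axis and on the four certified
surfaces `ρ/ρ_e = 1/4, 1/2, 3/4, 1`.** [cite: Jardin2010, §8.5.4 eq. (8.134)] -/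
theorem mercier_profile_of_ge {F : ℝ} (hF : MercierAxis.FmercHi ≤ F) :
    Mercier.NearAxis.MercierCriterion (MercierAxis.q0 F) MercierAxis.elong 0 0
    ∧ (MercierQ1.lcQ1Data F).MercierCriterion ∧ (MercierMid.lcMidData F).MercierCriterion
    ∧ (MercierQ3.lcQ3Data F).MercierCriterion ∧ (MercierEdge.lcEdgeData F).MercierCriterion := by
  have h1 : MercierQ1.gMercQ1Hi ≤ F := le_trans (by unfold MercierQ1.gMercQ1Hi MercierAxis.FmercHi; norm_num) hF
  have h2 : MercierMid.gMercMidHi ≤ F := le_trans (by unfold MercierMid.gMercMidHi MercierAxis.FmercHi; norm_num) hF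
  have h3 : MercierQ3.gMercQ3Hi ≤ F := le_trans (by unfold MercierQ3.gMercQ3Hi MercierAxis.FmercHi; norm_num) hF
  have h4 : MercierEdge.gMercEdgeHi ≤ F := le_trans (by unfold MercierEdge.gMercEdgeHi MercierAxis.FmercHi; norm_num) hF
  exact ⟨MercierAxis.mercier_elong_of_le hF, MercierQ1.mercierCriterion_lcQ1Data_of_ge h1,
    MercierMid.mercierCriterion_lcMidData_of_ge h2, MercierQ3.mercierCriterion_lcQ3Data_of_ge h3,
    MercierEdge.mercierCriterion_lcEdgeData_of_ge h4⟩

/-- **For every `0 < F ≤ g_M⁻(edge) = 0.36703156245` the criterion FAILS on all five surfaces.** [cite: Jardin2010, §8.5.4 eq. (8.134)] -/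
theorem not_mercier_profile_of_le {F : ℝ} (hF0 : 0 < F) (hF : F ≤ MercierEdge.gMercEdgeLo) :
    ¬ Mercier.NearAxis.MercierCriterion (MercierAxis.q0 F) MercierAxis.elong 0 0
    ∧ ¬ (MercierQ1.lcQ1Data F).MercierCriterion ∧ ¬ (MercierMid.lcMidData F).MercierCriterion
    ∧ ¬ (MercierQ3.lcQ3Data F).MercierCriterion ∧ ¬ (MercierEdge.lcEdgeData F).MercierCriterion := by
  have h0 : F ≤ MercierAxis.FmercLo := le_trans hF (by unfold MercierEdge.gMercEdgeLo MercierAxis.FmercLo; norm_num)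
  have h1 : F ≤ MercierQ1.gMercQ1Lo := le_trans hF (by unfold MercierEdge.gMercEdgeLo MercierQ1.gMercQ1Lo; norm_num)
  have h2 : F ≤ MercierMid.gMercMidLo := le_trans hF (by unfold MercierEdge.gMercEdgeLo MercierMid.gMercMidLo; norm_num)
  have h3 : F ≤ MercierQ3.gMercQ3Lo := le_trans hF (by unfold MercierEdge.gMercEdgeLo MercierQ3.gMercQ3Lo; norm_num)
  exact ⟨MercierAxis.not_mercier_elong_of_le hF0 h0, MercierQ1.not_mercierCriterion_lcQ1Data_of_le hF0 h1,
    MercierMid.not_mercierCriterion_lcMidData_of_le hF0 h2, MercierQ3.not_mercierCriterion_lcQ3Data_of_le hF0 h3,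
    MercierEdge.not_mercierCriterion_lcEdgeData_of_le hF0 hF⟩

/-- **The unstable region is an inner core:** for `g_M⁺(1/2) ≤ F ≤ g_M⁻(1/4)` (e.g. `F = 0.58`) the criterion HOLDS at the edge,
at `ρ/ρ_e = 3/4` and at `1/2`, but FAILS at `ρ/ρ_e = 1/4` and on the axis. [cite: Jardin2010, §8.5.4 eq. (8.134)] -/
theorem mercier_profile_window {F : ℝ} (hlo : MercierMid.gMercMidHi ≤ F) (hhi : F ≤ MercierQ1.gMercQ1Lo) :
    (MercierEdge.lcEdgeData F).MercierCriterion ∧ (MercierQ3.lcQ3Data F).MercierCriterion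
    ∧ (MercierMid.lcMidData F).MercierCriterion
    ∧ ¬ (MercierQ1.lcQ1Data F).MercierCriterion ∧ ¬ Mercier.NearAxis.MercierCriterion (MercierAxis.q0 F) MercierAxis.elong 0 0 := by
  have hF0 : 0 < F := lt_of_lt_of_le (by unfold MercierMid.gMercMidHi; norm_num) hlo
  have h3 : MercierQ3.gMercQ3Hi ≤ F := le_trans (by unfold MercierQ3.gMercQ3Hi MercierMid.gMercMidHi; norm_num) hlo
  have h4 : MercierEdge.gMercEdgeHi ≤ F := le_trans (by unfold MercierEdge.gMercEdgeHi MercierMid.gMercMidHi; norm_num) hlo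
  have h0 : F ≤ MercierAxis.FmercLo := le_trans hhi (by unfold MercierQ1.gMercQ1Lo MercierAxis.FmercLo; norm_num)
  exact ⟨MercierEdge.mercierCriterion_lcEdgeData_of_ge h4, MercierQ3.mercierCriterion_lcQ3Data_of_ge h3,
    MercierMid.mercierCriterion_lcMidData_of_ge hlo, MercierQ1.not_mercierCriterion_lcQ1Data_of_le hF0 hhi,
    MercierAxis.not_mercier_elong_of_le hF0 h0⟩

end Summit.Ventures.FusionMHD.Bench.SolovevPCFIter.MercierProfile

end
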